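import Summits.FinalStateConjecture.FinalStateConjecture.Theorems.EIHFluxBalanceModulatedKerrHandoffOneHoleSetup

/-!
# Route EIHFluxBalance — `ModulatedKerrHandoff`, stub `stub_oneHoleMatching`: the far-regime bound

Helper file for the crux `stmt-FinalStateConjecture-10167`
(`Summit.FinalStateConjecture.FinalStateConjecture.Theses.EIHFluxBalance.ModulatedKerrHandoff`),
line `photon-rocket-modulation`, stub `stub_oneHoleMatching`; continuation of `…OneHoleSetup`.

`far_pointwise`: there are `K ≥ 0` and `T > 0` such that at every lab point `x` with `x⁰ ≥ T` and
`‖x̲ − ξ(x⁰)‖ ≥ (1 − v) x⁰ / 2`, both the retarded summand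
`boostedKerrBilin (Λ(U x)) (U x, ξ(U x)) (Mf(U x)) a x − η` and the instantaneous one
`boostedKerrBilin (Λ(x⁰)) (x⁰, ξ(x⁰)) M a x − η` have all derivatives of order `≤ 3` bounded by
`K / ‖x̲ − ξ(x⁰)‖`. Assembly of `…OneHoleSetup` (sizes of the parameter maps), `…OneHoleBoxes` (the
parameter point lies in the compact box), `…OneHoleKernel` (kernel bounds, kernel identity) and
`OneHole.ck_comp`. Kerr–Schild 1965, §3.
-/

noncomputable section

-- `Summit.<S>.<S>.…` (single-problem summit, D-0017) trips core's duplicate-namespace linter.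
set_option linter.dupNamespace false

open Set Filter Function Literature.Geometry.Lorentzian
open scoped Topology ContDiff

namespace Summit.FinalStateConjecture.FinalStateConjecture.Theorems

namespace OneHole

section Far

variable {M a rin : ℝ} {Mf : ℝ → ℝ} {Λ : ℝ → lorentzGroup} {ξ : ℝ → E3} {Uc : E4 → ℝ} {v A γ κ : ℝ}

/-- Size of the lab time and of the clock in the far regime: with `t ≥ 0`, `‖ξ t‖ ≤ t`, `d ≥ c₁ t`,
`d ≥ 1`, `0 < c₁ ≤ 1`: `d⁻¹ ‖x‖ ≤ 2/c₁ + 1` and `d⁻¹ (|U| + ‖ξ U‖ + 1 + A) ≤ 2/c₁ + 2/(1 − v) + ‖ξ 0‖ + 1 + A`.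
[folklore] -/
theorem far_sizes (hsm : ContDiff ℝ ∞ ξ) (hvel : 0 ≤ v ∧ v < 1 ∧ ∀ u, ‖deriv ξ u‖ ≤ v)
    (hclock : ∀ x, x 0 - Uc x = ‖E4.spatial x - ξ (Uc x)‖) {x : E4} {c₁ A : ℝ} (hc₁ : 0 < c₁)
    (ht : 0 ≤ x 0) (hξt : ‖ξ (x 0)‖ ≤ x 0) (hd : c₁ * x 0 ≤ ‖E4.spatial x - ξ (x 0)‖)
    (hd1 : 1 ≤ ‖E4.spatial x - ξ (x 0)‖) (hA : 0 ≤ A) :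
    ‖E4.spatial x - ξ (x 0)‖⁻¹ * ‖x‖ ≤ 2 / c₁ + 1 ∧
      ‖E4.spatial x - ξ (x 0)‖⁻¹ * (|Uc x| + ‖ξ (Uc x)‖ + 1 + A) ≤ 2 / c₁ + 2 / (1 - v) + (‖ξ 0‖ + 1 + A) := by
  set d := ‖E4.spatial x - ξ (x 0)‖ with hd_def
  have hd0 : 0 < d := one_pos.trans_le hd1
  have htd : x 0 ≤ d / c₁ := by rw [le_div_iff₀ hc₁]; linarith
  have h1v : 0 < 1 - v := by linarith [hvel.2.1]
  constructor
  · rw [inv_mul_le_iff₀ hd0]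
    have hx := norm_point_le x (ξ (x 0))
    rw [abs_of_nonneg ht] at hx
    have h2t : 2 * x 0 ≤ d * 2 / c₁ := by rw [le_div_iff₀ hc₁]; nlinarith
    have : d * (2 / c₁ + 1) = d * 2 / c₁ + d := by ring
    rw [this]
    linarith
  · have hΔ := retardation_nonneg hclock x
    have hΔd : (1 - v) * (x 0 - Uc x) ≤ d := retardation_le_dist hsm hvel.1 hvel.2.2 hclock x
    have hU : |Uc x| ≤ x 0 + (x 0 - Uc x) := by
      rw [abs_le]; constructor <;> linarith
    have hξU : ‖ξ (Uc x)‖ ≤ ‖ξ 0‖ + |Uc x| := by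
      have h := norm_sub_le_of_deriv_le hsm hvel.1 hvel.2.2 (Uc x) 0
      rw [sub_zero] at h
      have := norm_le_norm_sub_add (ξ (Uc x)) (ξ 0)
      have hv1 : v * |Uc x| ≤ 1 * |Uc x| := mul_le_mul_of_nonneg_right hvel.2.1.le (abs_nonneg _)
      linarith
    rw [inv_mul_le_iff₀ hd0]
    have hΔ' : x 0 - Uc x ≤ d / (1 - v) := by rw [le_div_iff₀ h1v]; linarith
    have e1 : |Uc x| ≤ d / c₁ + d / (1 - v) := by linarith
    have e2 : ‖ξ 0‖ + 1 + A ≤ d * (‖ξ 0‖ + 1 + A) := by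
      have : 0 ≤ ‖ξ 0‖ + 1 + A := by positivity
      nlinarith
    calc |Uc x| + ‖ξ (Uc x)‖ + 1 + A ≤ 2 * |Uc x| + (‖ξ 0‖ + 1 + A) := by linarith
      _ ≤ 2 * (d / c₁ + d / (1 - v)) + d * (‖ξ 0‖ + 1 + A) := by linarith
      _ = d * (2 / c₁ + 2 / (1 - v) + (‖ξ 0‖ + 1 + A)) := by ring

/-- **The far-regime bound.** There are `K ≥ 0` and `T > 0` such that at every lab point `x` with
`x⁰ ≥ T` at lab distance `d = ‖x̲ − ξ(x⁰)‖ ≥ (1 − v) x⁰ / 2` from the centre, the retarded and the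
instantaneous summands have all derivatives of order `≤ 3` bounded by `K / d`. Kerr–Schild 1965, §3
(asymptotic flatness of the ansatz), in the modulated retarded form. [cite: KerrSchild1965, §3] -/
theorem far_pointwise (hsub : Kerr.IsSubextremal M a ∧ Kerr.rMinus M a < rin ∧ rin < Kerr.rPlus M a)
    (hsm : ContDiff ℝ ∞ ξ ∧ ContDiff ℝ ∞ (fun t ↦ ((Λ t : E4 ≃L[ℝ] E4) : E4 →L[ℝ] E4)) ∧ ContDiff ℝ ∞ Mf)
    (hvel : 0 ≤ v ∧ v < 1 ∧ ∀ u, ‖deriv ξ u‖ ≤ v)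
    (hal : ∀ u, (Λ u : E4 ≃L[ℝ] E4) (E4.basisVector 0) =
      ((Λ u : E4 ≃L[ℝ] E4) (E4.basisVector 0)) 0 • E4.ofTimeSpace 1 (deriv ξ u) ∧
      1 ≤ ((Λ u : E4 ≃L[ℝ] E4) (E4.basisVector 0)) 0 ∧ ((Λ u : E4 ≃L[ℝ] E4) (E4.basisVector 0)) 0 ≤ γ)
    (hgl : ∀ u, (∀ k, 1 ≤ k → k ≤ 5 → ‖iteratedDeriv k ξ u‖ ≤ A) ∧
      ∀ k ≤ 4, ‖iteratedDeriv k (fun t ↦ ((Λ t : E4 ≃L[ℝ] E4) : E4 →L[ℝ] E4)) u‖ ≤ A ∧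
        |iteratedDeriv k Mf u| ≤ A)
    (hcone : 0 < κ ∧ κ < 1 ∧ ∀ᶠ t in atTop, ‖ξ t‖ ≤ κ ^ 2 * t)
    (hclock : ∀ x, x 0 - Uc x = ‖E4.spatial x - ξ (Uc x)‖)
    (hU : ContDiffOn ℝ ∞ Uc {x : E4 | E4.spatial x ≠ ξ (Uc x)}) :
    ∃ K T : ℝ, 0 ≤ K ∧ 0 < T ∧ ∀ x : E4, T ≤ x 0 → (1 - v) / 2 * x 0 ≤ ‖E4.spatial x - ξ (x 0)‖ →
      0 < Kerr.radius a ((Λ (Uc x) : E4 ≃L[ℝ] E4).symm (x - E4.ofTimeSpace (Uc x) (ξ (Uc x)))) ∧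
      ∀ m ≤ 3,
        ‖iteratedFDeriv ℝ m (fun y ↦ boostedKerrBilin (Λ (Uc y)) (E4.ofTimeSpace (Uc y) (ξ (Uc y)))
          (Mf (Uc y)) a y - Minkowski.bilin) x‖ ≤ K / ‖E4.spatial x - ξ (x 0)‖ ∧
        ‖iteratedFDeriv ℝ m (fun y ↦ boostedKerrBilin (Λ (y 0)) (E4.ofTimeSpace (y 0) (ξ (y 0)))
          M a y - Minkowski.bilin) x‖ ≤ K / ‖E4.spatial x - ξ (x 0)‖ := by
  -- constants
  have hM : 0 < M := hsub.1.pos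
  have hA0 : 0 ≤ A := A_nonneg hgl
  have hγ1 : 1 ≤ γ := one_le_gamma hal
  have h1v : 0 < 1 - v := by linarith [hvel.2.1]
  have h1v' : 0 < 1 + v := by linarith [hvel.1]
  obtain ⟨Cθ, hCθ0, hCθ⟩ := exists_norm_iteratedDeriv_theta_le
  have hCθΛ := hCθ Λ hsm.2.1
  obtain ⟨T₁, hT₁⟩ := eventually_atTop.mp hcone.2.2
  obtain ⟨DU, hDU1, hDU⟩ := exists_clock_deriv_bound hsm.1 hvel.1 hvel.2.1 hvel.2.2
    (fun u k hk1 hk ↦ (hgl u).1 k hk1 (by omega)) hclock hU one_pos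
  set c₁ : ℝ := (1 - v) / 2 with hc₁
  have hc₁0 : 0 < c₁ := by positivity
  have hc₁1 : c₁ ≤ 1 := by rw [hc₁]; linarith only [hvel.1]
  set Rb : ℝ := 2 * (1 + 3 * γ) / (1 - v) with hRb
  set rb : ℝ := (1 - v) / (1 + v) / 2 with hrb
  have hrb0 : 0 < rb := by positivity
  have hrb2 : rb ≤ 1 / 2 := by
    have h : (1 - v) / (1 + v) ≤ 1 := by rw [div_le_one h1v']; linarith only [hvel.1]
    rw [hrb]; linarith only [h]
  obtain ⟨B, hB0, hB⟩ := exists_ck_kernel 3 (M + A) (1 + 3 * γ) |a| Rb hrb0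
  set X₀ : ℝ := 2 / c₁ + 1 with hX₀
  set Xb : ℝ := 2 / c₁ + 2 / (1 - v) + (‖ξ 0‖ + 1 + A) with hXb
  set Dp₁ : ℝ := max (6 * A * DU ^ 3) (max (6 * (Cθ * A) * DU ^ 3)
    (max 0 (6 * (Cθ * A) * DU ^ 3 * X₀ + 8 * ((1 + 3 * γ) + 6 * (Cθ * A) * DU ^ 3) +
      6 * (4 * (Cθ * A) * Xb) * DU ^ 3))) with hDp₁
  set Dp₀ : ℝ := max 0 (max (6 * (Cθ * A))
    (max 0 (6 * (Cθ * A) * X₀ + 8 * ((1 + 3 * γ) + 6 * (Cθ * A)) + 6 * (4 * (Cθ * A) * Xb))))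
    with hDp₀
  set Dd : ℝ := max (max 1 (4 * |a|)) (max (max 1 (2 * |a| * (1 + v) / (1 - v))) 2) with hDd
  set T : ℝ := max 1 (max T₁ (Dd / c₁)) with hT
  refine ⟨6 * B * max 1 Dp₁ ^ 3 + 6 * B * max 1 Dp₀ ^ 3, T, by positivity, lt_max_of_lt_left one_pos,
    fun x hxT hxd ↦ ?_⟩
  -- the point
  set t : ℝ := x 0 with ht
  set d : ℝ := ‖E4.spatial x - ξ (x 0)‖ with hd_def
  have ht1 : 1 ≤ t := (le_max_left _ _).trans hxT
  have ht0 : 0 ≤ t := zero_le_one.trans ht1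
  have htT₁ : T₁ ≤ t := ((le_max_left _ _).trans (le_max_right _ _)).trans hxT
  have hκ2 : κ ^ 2 ≤ 1 := by nlinarith [hcone.1, hcone.2.1]
  have hξt : ‖ξ t‖ ≤ t := (hT₁ t htT₁).trans (by nlinarith only [mul_le_mul_of_nonneg_right hκ2 ht0])
  have hdD : Dd ≤ d := by
    have h := ((le_max_right _ _).trans (le_max_right _ _)).trans hxT
    rw [div_le_iff₀ hc₁0] at h
    have h' : c₁ * t ≤ d := hxd
    linarith only [h, h', mul_comm c₁ t]
  have hd2 : 2 ≤ d := ((le_max_right _ _).trans (le_max_right _ _)).trans hdD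
  have hd1 : 1 ≤ d := by linarith only [hd2]
  have hd0 : 0 < d := by linarith only [hd2]
  set ε : ℝ := d⁻¹ with hε
  have hε0 : 0 < ε := inv_pos.mpr hd0
  have hε1 : ε ≤ 1 := inv_le_one_of_one_le₀ hd1
  -- retardation
  have hΔ0 := retardation_nonneg hclock x
  have hΔ1 : (1 - v) * (x 0 - Uc x) ≤ d := retardation_le_dist hsm.1 hvel.1 hvel.2.2 hclock x
  have hΔ2 : d ≤ (1 + v) * (x 0 - Uc x) := dist_le_retardation hsm.1 hvel.1 hvel.2.2 hclock x
  have hΔr : 1 ≤ x 0 - Uc x := by nlinarith only [hvel.1, hvel.2.1, hΔ2, hd2, hΔ0]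
  have hUx := hDU x hΔr
  obtain ⟨hsz₁, hsz₂⟩ := far_sizes (A := A) hsm.1 hvel hclock hc₁0 ht0 hξt hxd hd1 hA0
  -- sizes of the parameter maps
  have hp₁ := far_ck₁_ret (a := a) hsm hal hgl hCθ0 hCθΛ hDU1 hUx hε0 hε1 hsz₁ hsz₂
  have hξtA : ε * (|x 0| + ‖ξ (x 0)‖ + 1 + A) ≤ Xb := by
    rw [abs_of_nonneg ht0]
    have h0 : ε * (1 + A) ≤ 1 + A := mul_le_of_le_one_left (by positivity) hε1
    have h1 : ε * ‖ξ t‖ ≤ ε * t := mul_le_mul_of_nonneg_left hξt hε0.le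
    have h2 : ε * (2 * t) ≤ 2 / c₁ := by
      have h' : c₁ * t ≤ d := hxd
      rw [hε, inv_mul_le_iff₀ hd0, mul_div_assoc', le_div_iff₀ hc₁0]
      linarith only [h']
    have h3 : (0 : ℝ) ≤ 2 / (1 - v) := by positivity
    have h4 : 0 ≤ ‖ξ 0‖ := norm_nonneg _
    have h5 : ε * (t + ‖ξ t‖ + 1 + A) = ε * t + ε * ‖ξ t‖ + ε * (1 + A) := by ring
    rw [hXb, h5]
    linarith only [h0, h1, h2, h3, h4]
  have hp₀ := far_ck₁_inst (M := M) (a := a) hsm hal hgl hCθ0 hCθΛ (x := x) hε0 hε1 hsz₁ hξtA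
  have hRb1 : 1 + 3 * γ ≤ Rb := by
    rw [hRb, le_div_iff₀ h1v]; nlinarith only [hvel.1, hγ1, hvel.2.1]
  -- the retarded parameter point lies in the box
  have hY₁lo := retardation_le_norm_restPosition_ret (hclock x) (hal (Uc x)).1 (hal (Uc x)).2.1
    (hvel.2.2 (Uc x)) hvel.2.1
  have hY₁hi := (norm_restPosition_ret_le (γ := γ) (hclock x) (hal (Uc x)).2.1 (hal (Uc x)).2.2).2
  have hbox₁ := box_far_ret (a := a) (by linarith only [hγ1] : (0:ℝ) ≤ γ) hvel.1 hvel.2.1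
    (((le_max_left _ _).trans (le_max_right _ _)).trans hdD) hΔ1 hΔ2 hY₁lo hY₁hi
  -- positivity of the retarded rest-frame radius
  have hposfar : 0 < Kerr.radius a ((Λ (Uc x) : E4 ≃L[ℝ] E4).symm
      (x - E4.ofTimeSpace (Uc x) (ξ (Uc x)))) := by
    have h := hbox₁.2
    rw [radius_slice_smul (inv_pos.mpr hd0)] at h
    have h2 : 0 < Kerr.radius a (E4.ofTimeSpace 0
        (E4.spatial ((Λ (Uc x) : E4 ≃L[ℝ] E4).symm (x - E4.ofTimeSpace (Uc x) (ξ (Uc x)))))) := by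
      by_contra hneg
      rw [not_lt] at hneg
      have : d⁻¹ * Kerr.radius a (E4.ofTimeSpace 0 (E4.spatial ((Λ (Uc x) : E4 ≃L[ℝ] E4).symm
          (x - E4.ofTimeSpace (Uc x) (ξ (Uc x)))))) ≤ 0 :=
        mul_nonpos_of_nonneg_of_nonpos (inv_nonneg.mpr hd0.le) hneg
      have hpos : 0 < (1 - v) / (1 + v) / 2 := by positivity
      linarith only [this, h, hpos]
    rwa [Kerr.radius_eq_of_spatial_eq a (E4.spatial_ofTimeSpace 0 _)] at h2
  refine ⟨hposfar, fun m hm ↦ ?_⟩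
  have hK₁ := hB (Mf (Uc x), ((((Λ (Uc x) : E4 ≃L[ℝ] E4).symm : E4 ≃L[ℝ] E4) : E4 →L[ℝ] E4),
      (ε * a, ε • E4.spatial ((Λ (Uc x) : E4 ≃L[ℝ] E4).symm (x - E4.ofTimeSpace (Uc x) (ξ (Uc x)))))))
    ((abs_mass_le hgl (Uc x)).trans (by linarith only [hM] : A ≤ M + A))
    (norm_theta_le (hal (Uc x)).2.1 (hal (Uc x)).2.2)
    (by rw [abs_mul, abs_of_pos hε0]; exact mul_le_of_le_one_left (abs_nonneg a) hε1)
    hbox₁.1 hbox₁.2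
  have hcomp₁ := ck_comp
    (g := fun p : ℝ × ((E4 →L[ℝ] E4) × (ℝ × E3)) ↦
      (Kerr.bilin p.1 p.2.2.1 (E4.ofTimeSpace 0 p.2.2.2) - Minkowski.bilin).bilinearComp p.2.1 p.2.1)
    (f := fun y ↦ ((Mf (Uc y), ((((Λ (Uc y) : E4 ≃L[ℝ] E4).symm : E4 ≃L[ℝ] E4) : E4 →L[ℝ] E4),
        (ε * a, ε • E4.spatial ((Λ (Uc y) : E4 ≃L[ℝ] E4).symm (y - E4.ofTimeSpace (Uc y) (ξ (Uc y))))))) :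
        ℝ × ((E4 →L[ℝ] E4) × (ℝ × E3)))) (x := x) hK₁ hp₁
  -- the instantaneous parameter point lies in the box
  have hY₀ := norm_restPosition_inst (Λ := Λ (x 0)) (x := x) (t := x 0) rfl (ξ (x 0)) (hal (x 0)).2.1
    (hal (x 0)).2.2
  have hbox₀ := box_far_inst (a := a) (γ := γ) ((le_max_left _ _).trans hdD) hY₀.1 hY₀.2
  have hK₀ := hB (M, ((((Λ (x 0) : E4 ≃L[ℝ] E4).symm : E4 ≃L[ℝ] E4) : E4 →L[ℝ] E4),
      (ε * a, ε • E4.spatial ((Λ (x 0) : E4 ≃L[ℝ] E4).symm (x - E4.ofTimeSpace (x 0) (ξ (x 0)))))))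
    (by rw [abs_of_pos hM]; linarith only [hA0])
    (norm_theta_le (hal (x 0)).2.1 (hal (x 0)).2.2)
    (by rw [abs_mul, abs_of_pos hε0]; exact mul_le_of_le_one_left (abs_nonneg a) hε1)
    (hbox₀.1.trans hRb1) (hrb2.trans hbox₀.2)
  have hcomp₀ := ck_comp
    (g := fun p : ℝ × ((E4 →L[ℝ] E4) × (ℝ × E3)) ↦
      (Kerr.bilin p.1 p.2.2.1 (E4.ofTimeSpace 0 p.2.2.2) - Minkowski.bilin).bilinearComp p.2.1 p.2.1)
    (f := fun y ↦ ((M, ((((Λ (y 0) : E4 ≃L[ℝ] E4).symm : E4 ≃L[ℝ] E4) : E4 →L[ℝ] E4),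
        (ε * a, ε • E4.spatial ((Λ (y 0) : E4 ≃L[ℝ] E4).symm (y - E4.ofTimeSpace (y 0) (ξ (y 0))))))) :
        ℝ × ((E4 →L[ℝ] E4) × (ℝ × E3)))) (x := x) hK₀ hp₀
  -- the kernel identities
  have hid₁ : (fun y ↦ boostedKerrBilin (Λ (Uc y)) (E4.ofTimeSpace (Uc y) (ξ (Uc y))) (Mf (Uc y)) a y -
      Minkowski.bilin) = fun y ↦ ε • (fun p : ℝ × ((E4 →L[ℝ] E4) × (ℝ × E3)) ↦
      (Kerr.bilin p.1 p.2.2.1 (E4.ofTimeSpace 0 p.2.2.2) - Minkowski.bilin).bilinearComp p.2.1 p.2.1)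
      ((Mf (Uc y), ((((Λ (Uc y) : E4 ≃L[ℝ] E4).symm : E4 ≃L[ℝ] E4) : E4 →L[ℝ] E4),
        (ε * a, ε • E4.spatial ((Λ (Uc y) : E4 ≃L[ℝ] E4).symm (y - E4.ofTimeSpace (Uc y) (ξ (Uc y))))))) :
        ℝ × ((E4 →L[ℝ] E4) × (ℝ × E3))) :=
    funext fun y ↦ boostedKerrBilin_sub_eq_smul_kernel (Λ (Uc y)) _ (Mf (Uc y)) a hε0 y
  have hid₀ : (fun y ↦ boostedKerrBilin (Λ (y 0)) (E4.ofTimeSpace (y 0) (ξ (y 0))) M a y -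
      Minkowski.bilin) = fun y ↦ ε • (fun p : ℝ × ((E4 →L[ℝ] E4) × (ℝ × E3)) ↦
      (Kerr.bilin p.1 p.2.2.1 (E4.ofTimeSpace 0 p.2.2.2) - Minkowski.bilin).bilinearComp p.2.1 p.2.1)
      ((M, ((((Λ (y 0) : E4 ≃L[ℝ] E4).symm : E4 ≃L[ℝ] E4) : E4 →L[ℝ] E4),
        (ε * a, ε • E4.spatial ((Λ (y 0) : E4 ≃L[ℝ] E4).symm (y - E4.ofTimeSpace (y 0) (ξ (y 0))))))) :
        ℝ × ((E4 →L[ℝ] E4) × (ℝ × E3))) :=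
    funext fun y ↦ boostedKerrBilin_sub_eq_smul_kernel (Λ (y 0)) _ M a hε0 y
  -- the bounds
  have hD₁ : 0 ≤ 6 * B * max 1 Dp₁ ^ 3 := by positivity
  have hD₀ : 0 ≤ 6 * B * max 1 Dp₀ ^ 3 := by positivity
  have key : ∀ {f : E4 → E4 →L[ℝ] E4 →L[ℝ] ℝ} {C : ℝ}, (ContDiffAt ℝ 3 f x ∧
      ∀ i ≤ 3, ‖iteratedFDeriv ℝ i f x‖ ≤ C) → 0 ≤ C →
      ‖iteratedFDeriv ℝ m (fun y ↦ ε • f y) x‖ ≤ C / d := by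
    intro f C hf hC
    have h := (ck_const_smul hf ε).2 m hm
    rwa [abs_of_pos hε0, hε, ← div_eq_inv_mul] at h
  rw [show (Nat.factorial 3 : ℝ) = 6 by norm_num] at hcomp₁ hcomp₀
  constructor
  · rw [hid₁]
    exact (key hcomp₁ hD₁).trans (div_le_div_of_nonneg_right (by linarith only [hD₀]) hd0.le)
  · rw [hid₀]
    exact (key hcomp₀ hD₀).trans (div_le_div_of_nonneg_right (by linarith only [hD₁]) hd0.le)

end Far

end OneHole

/-- Registered sub-goal form (stub `oneHole_far_sizes` of the crux item) of `OneHole.far_sizes`: in the far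
regime the lab time, the retarded time and the centre are `O(d)`. [folklore] -/
theorem oneHole_far_sizes : open Literature.Geometry.Lorentzian in ∀ {ξ : ℝ → E3} {Uc : E4 → ℝ} {v : ℝ}, ContDiff ℝ ((⊤ : ℕ∞) : WithTop ℕ∞) ξ → (0 ≤ v ∧ v < 1 ∧ ∀ u, ‖deriv ξ u‖ ≤ v) → (∀ x, x 0 - Uc x = ‖E4.spatial x - ξ (Uc x)‖) → ∀ {x : E4} {c₁ A : ℝ}, 0 < c₁ → 0 ≤ x 0 → ‖ξ (x 0)‖ ≤ x 0 → c₁ * x 0 ≤ ‖E4.spatial x - ξ (x 0)‖ → 1 ≤ ‖E4.spatial x - ξ (x 0)‖ → 0 ≤ A → ‖E4.spatial x - ξ (x 0)‖⁻¹ * ‖x‖ ≤ 2 / c₁ + 1 ∧ ‖E4.spatial x - ξ (x 0)‖⁻¹ * (|Uc x| + ‖ξ (Uc x)‖ + 1 + A) ≤ 2 / c₁ + 2 / (1 - v) + (‖ξ 0‖ + 1 + A) :=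
  fun hsm hvel hclock _ _ _ hc₁ ht hξt hd hd1 hA ↦ OneHole.far_sizes hsm hvel hclock hc₁ ht hξt hd hd1 hA

end Summit.FinalStateConjecture.FinalStateConjecture.Theorems

end
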